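import Literature.Probability.RandomPlanarGeometry.SLECardyIto
import Literature.Probability.RandomPlanarGeometry.SLEMartingaleProofs
import Literature.Probability.Process.StoppedMartingale
import Literature.Probability.Process.DoobMaximalIneq
import Literature.Probability.Process.MartingaleLimit
import HarnessLib

/-!
# The Cardy observable of SLE₆ is a martingale (crit-perc.S22, direction `κ = 6`)

Topic `Probability/RandomPlanarGeometry`; theorems (and auxiliary real-valued definitions) only.
Fourth proof file towards **crit-perc.S22**
(`Literature.Probability.RandomPlanarGeometry.isLocalMartingale_stoppedProcess_cardyObservable_iff`,
`SLEMartingale`).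

For `κ = 6` the Itô drift of `F(η_t)` vanishes (`cardyDrift_six`, `SLECardyIto`), so for every
level `n` the observable stopped at the level stopping time `ρₙ` (`cardyLevelTime` with levels
`x₀/(n+2)`, `x₀+n+1`, `min(x₁-x₀, x₂-x₁)/(n+2)`) is a bounded continuous martingale `Mⁿ`
(`martingale_cardyObsStopped_six`). As `n → ∞`, `ρₙ ↑ T` (the first swallowing time of the marks)
and `Mⁿ_t → cardyObservable 6 x t` almost surely: before `T` trivially, and from `T` on because
the left limit `lim_{s↑T} F(η_s)` exists almost surely. The latter is proved by an `L²`/Doob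
argument which replaces the upcrossing inequality: `Mⁿ = (Mⁿ')^{ρₙ}` for `n ≤ n'`, so
`E[Mⁿ_t Mⁿ'_t] = E[(Mⁿ_t)²]` (orthogonality of martingale increments across a stopping time,
`integral_stoppedProcess_mul_eq_integral_sq`, by discrete optional sampling along dyadic
approximations), whence `E[(Mⁿ'_t - Mⁿ_t)²] = aₙ' - aₙ` with `aₙ = E[(Mⁿ_t)²] ↑ a_∞ ≤ 1`, and Doob's
maximal inequality (`doob_sq_maximal_ineq_of_continuous`) bounds the probability that `F(η)`
oscillates by `ε` on `[ρₙ, T)` by `(a_∞ - aₙ)/ε² → 0`; so the paths are a.s. Cauchy at `T-`.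
Bounded a.s. limits of martingales with a strongly adapted limit are martingales
(`martingale_of_tendsto_of_abs_le`, with `stronglyAdapted_cardyObservable_holds` of
`SLEMartingaleProofs`): `martingale_cardyObservable_six`.

## References

* W. Werner, *Lectures on two-dimensional critical percolation*, IAS/Park City (2007), §3.
* G. Lawler, O. Schramm, W. Werner, *Values of Brownian intersection exponents I*, Acta Math. 187
  (2001), §3.
* D. Revuz, M. Yor, *Continuous Martingales and Brownian Motion* (1999), Ch. II, Thm (1.7),
  Thm (3.2); Ch. IV §1.
* J.-F. Le Gall, *Brownian Motion, Martingales, and Stochastic Calculus* (2016), Thm 3.22,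
  Cor. 3.24.
-/

noncomputable section

open MeasureTheory ProbabilityTheory Filter Set Topology
open scoped NNReal ENNReal

namespace Literature.Probability.RandomPlanarGeometry

open Loewner Literature.Probability.Process Literature.Analysis.FunctionSpaces

/-! ### Orthogonality of martingale increments across a stopping time -/

/-- **`E[N_{t∧ρ} N_t] = E[N_{t∧ρ}²]`** for a bounded martingale `N` with continuous paths and a
stopping time `ρ` of a raw filtration of `ℝ≥0` (so `E[(N_t - N_{t∧ρ})²] = E[N_t²] - E[N_{t∧ρ}²]`).
Proof: for the dyadic stopping times `τⱼ = t ∧ ⌈ρ⌉ⱼ ↓ t ∧ ρ` (countable range),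
`N_{τⱼ} = E[N_t | 𝓕_{τⱼ}]` (Mathlib's discrete optional sampling
`stoppedValue_ae_eq_condExp_of_le_const_of_countable_range`), so `E[N_{τⱼ} N_t] = E[N_{τⱼ}²]` by the
pull-out property; then `j → ∞` by dominated convergence and path continuity.
Revuz–Yor (1999), Ch. II, Thm (3.2); Le Gall (2016), Thm 3.22 / Cor. 3.24.
[cite: RevuzYor1999, Ch. II Thm (3.2)] -/
theorem integral_stoppedProcess_mul_eq_integral_sq {Ω : Type*} {m : MeasurableSpace Ω}
    {P : Measure Ω} [IsFiniteMeasure P] {𝓕 : Filtration ℝ≥0 m} {N : ℝ≥0 → Ω → ℝ}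
    (hN : Martingale N 𝓕 P) (hcont : ∀ ω, Continuous (N · ω)) {C : ℝ} (hbd : ∀ t ω, |N t ω| ≤ C)
    {ρ : Ω → WithTop ℝ≥0} (hρ : IsStoppingTime 𝓕 ρ) (t : ℝ≥0) :
    ∫ ω, stoppedProcess N ρ t ω * N t ω ∂P = ∫ ω, stoppedProcess N ρ t ω ^ 2 ∂P := by
  have hprog : IsStronglyProgressive 𝓕 N :=
    hN.stronglyAdapted.isStronglyProgressive_of_continuous hcont
  -- dyadic stopping times `τ j = t ∧ ⌈ρ⌉ⱼ`, countable range, `≤ t`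
  set τ : ℕ → Ω → WithTop ℝ≥0 := fun j ω ↦ min (t : WithTop ℝ≥0) (dyadicCeilTop j (ρ ω)) with hτdef
  have hτ : ∀ j, IsStoppingTime 𝓕 (τ j) := fun j ↦
    (isStoppingTime_const 𝓕 _).min (hρ.isOptionalTime.isStoppingTime_dyadicCeilTop j)
  have hτle : ∀ j (ω : Ω), τ j ω ≤ t := fun j ω ↦ min_le_left _ _
  have hcount : ∀ j, (Set.range (τ j)).Countable := by
    intro j
    refine ((countable_range_dyadicCeilTop j).insert (t : WithTop ℝ≥0)).mono ?_
    rintro _ ⟨ω, rfl⟩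
    change min (t : WithTop ℝ≥0) (dyadicCeilTop j (ρ ω)) ∈
      insert (t : WithTop ℝ≥0) (Set.range (dyadicCeilTop j))
    rcases min_choice (t : WithTop ℝ≥0) (dyadicCeilTop j (ρ ω)) with h | h
    · rw [h]; exact Set.mem_insert _ _
    · rw [h]; exact Set.mem_insert_of_mem _ ⟨ρ ω, rfl⟩
  -- the stopped values `Z j = N_{τ j}`
  set Z : ℕ → Ω → ℝ := fun j ↦ stoppedValue N (τ j) with hZdef
  have hZmeas : ∀ j, StronglyMeasurable[(hτ j).measurableSpace] (Z j) := fun j ↦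
    (measurable_stoppedValue hprog (hτ j)).stronglyMeasurable
  have hZbd : ∀ j ω, |Z j ω| ≤ C := fun j ω ↦ hbd _ _
  have hZm : ∀ j, AEStronglyMeasurable (Z j) P := fun j ↦
    ((hZmeas j).mono (hτ j).measurableSpace_le).aestronglyMeasurable
  -- optional sampling and pull-out: `∫ Z j * N t = ∫ (Z j)²`
  have hj : ∀ j, ∫ ω, Z j ω * N t ω ∂P = ∫ ω, Z j ω ^ 2 ∂P := by
    intro j
    have hm : (hτ j).measurableSpace ≤ m := (hτ j).measurableSpace_le
    have hopt : Z j =ᵐ[P] P[N t | (hτ j).measurableSpace] :=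
      hN.stoppedValue_ae_eq_condExp_of_le_const_of_countable_range (hτ j) (hτle j) (hcount j)
    have h1 : P[Z j * N t | (hτ j).measurableSpace] =ᵐ[P] Z j * P[N t | (hτ j).measurableSpace] :=
      condExp_stronglyMeasurable_mul_of_bound hm (hZmeas j) (hN.integrable t) C
        (ae_of_all _ fun ω ↦ by rw [Real.norm_eq_abs]; exact hZbd j ω)
    calc ∫ ω, Z j ω * N t ω ∂P
        = ∫ ω, (P[Z j * N t | (hτ j).measurableSpace]) ω ∂P := (integral_condExp hm).symm
      _ = ∫ ω, (Z j * P[N t | (hτ j).measurableSpace]) ω ∂P := integral_congr_ae h1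
      _ = ∫ ω, Z j ω * Z j ω ∂P := by
          refine integral_congr_ae ?_
          filter_upwards [hopt] with ω hω
          simp only [Pi.mul_apply]
          rw [← hω]
      _ = ∫ ω, Z j ω ^ 2 ∂P := by
          congr 1; funext ω; ring
  -- pass to the limit `j → ∞`
  have hlimZ : ∀ ω, Tendsto (fun j ↦ Z j ω) atTop (𝓝 (stoppedProcess N ρ t ω)) := by
    intro ω
    simp only [hZdef, stoppedValue, stoppedProcess]
    exact ((hcont ω).tendsto _).comp (tendsto_untopA_min_dyadicCeilTop t (ρ ω))
  have hNtm : AEStronglyMeasurable (N t) P := (hN.integrable t).aestronglyMeasurable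
  have hA : Tendsto (fun j ↦ ∫ ω, Z j ω * N t ω ∂P) atTop
      (𝓝 (∫ ω, stoppedProcess N ρ t ω * N t ω ∂P)) := by
    refine tendsto_integral_of_dominated_convergence (fun ω ↦ C * |N t ω|)
      (fun j ↦ (hZm j).mul hNtm) (((hN.integrable t).abs).const_mul C) (fun j ↦ ae_of_all _ fun ω ↦ ?_)
      (ae_of_all _ fun ω ↦ (hlimZ ω).mul tendsto_const_nhds)
    rw [Real.norm_eq_abs, abs_mul]
    exact mul_le_mul_of_nonneg_right (hZbd j ω) (abs_nonneg _)
  have hB : Tendsto (fun j ↦ ∫ ω, Z j ω ^ 2 ∂P) atTop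
      (𝓝 (∫ ω, stoppedProcess N ρ t ω ^ 2 ∂P)) := by
    refine tendsto_integral_of_dominated_convergence (fun _ ↦ C ^ 2)
      (fun j ↦ (hZm j).pow 2) (integrable_const _) (fun j ↦ ae_of_all _ fun ω ↦ ?_)
      (ae_of_all _ fun ω ↦ (hlimZ ω).pow 2)
    rw [Real.norm_eq_abs, abs_pow]
    exact pow_le_pow_left₀ (abs_nonneg _) (hZbd j ω) 2
  rw [funext hj] at hA
  exact tendsto_nhds_unique hA hB

/-! ### Cardy's function extended continuously -/

/-- Cardy's function restricted to `[0, 1]` and extended constantly outside (Mathlib's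
`Set.IccExtend`): a continuous function on `ℝ` equal to `F` on `[0, 1]`; used to see continuity
of the stopped observables, whose cross-ratio stays in `(0, 1)`. [folklore] -/
def cardyFunctionExt : ℝ → ℝ :=
  IccExtend zero_le_one fun p : Icc (0 : ℝ) 1 ↦ cardyFunction p

/-- `cardyFunctionExt` is continuous (`F` is continuous on `[0, 1]`). [cite: CardyJPhysA1992] -/
theorem continuous_cardyFunctionExt : Continuous cardyFunctionExt :=
  (continuousOn_cardyFunction_holds.restrict).Icc_extend'

/-- On `[0, 1]`, `cardyFunctionExt = F`. [folklore] -/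
theorem cardyFunctionExt_of_mem {η : ℝ} (hη : η ∈ Icc (0 : ℝ) 1) :
    cardyFunctionExt η = cardyFunction η :=
  IccExtend_of_mem _ _ hη

/-! ### The level sequences and the stopped observables -/

section Levels

variable (κ : ℝ≥0) (x : Fin 3 → ℝ)

/-- Lower level sequence for `X⁰`: `x₀/(n+2) ↓ 0`. [folklore] -/
def levelLo (n : ℕ) : ℝ := x 0 / (n + 2)

/-- Upper level sequence for `X⁰`: `x₀ + n + 1 ↑ ∞`. [folklore] -/
def levelHi (n : ℕ) : ℝ := x 0 + n + 1

/-- Lower level sequence for the gaps: `min(x₁-x₀, x₂-x₁)/(n+2) ↓ 0`. [folklore] -/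
def levelGap (n : ℕ) : ℝ := min (x 1 - x 0) (x 2 - x 1) / (n + 2)

/-- **The `n`-th level stopping time** `ρₙ = cardyLevelTime κ x (levelLo x n) (levelHi x n)
(levelGap x n)` (`SLECardyFlow`); `ρₙ ↑ T`, the first swallowing time of the marks.
[cite: WernerPCMI2009, §3] -/
def cardyLevelTimeSeq (n : ℕ) (ω : ℝ≥0 → ℝ) : WithTop ℝ≥0 :=
  cardyLevelTime κ x (levelLo x n) (levelHi x n) (levelGap x n) ω

/-- **The Cardy observable stopped at the level stopping time** `ρ = cardyLevelTime κ x m M d`: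
`F(η(X⁰, X¹, X²)_{t∧ρ})`, the martingale part of `martingale_cardyObservable_sub_timeIntegral`
(`SLECardyIto`). [cite: WernerPCMI2009, §3] -/
def cardyObsStopped (m M d : ℝ) (t : ℝ≥0) (ω : ℝ≥0 → ℝ) : ℝ :=
  cardyFunction (cardyEta
    (stoppedProcess (sleRealFlowStop κ (x 0)) (cardyLevelTime κ x m M d) t ω)
    (stoppedProcess (sleRealFlowStop κ (x 1)) (cardyLevelTime κ x m M d) t ω)
    (stoppedProcess (sleRealFlowStop κ (x 2)) (cardyLevelTime κ x m M d) t ω))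

variable {κ x}

section LevelFacts

variable (hx : StrictMono x) (hx0 : 0 < x 0) (n : ℕ)
include hx0 in
/-- `0 < levelLo x n`. [folklore] -/
theorem levelLo_pos : 0 < levelLo x n := div_pos hx0 (by positivity)

include hx0 in
/-- `levelLo x n < x 0`. [folklore] -/
theorem levelLo_lt : levelLo x n < x 0 := by
  unfold levelLo
  rw [div_lt_iff₀ (by positivity)]
  nlinarith

/-- `x 0 < levelHi x n`. [folklore] -/
theorem lt_levelHi : x 0 < levelHi x n := by unfold levelHi; linarith [n.cast_nonneg (α := ℝ)]

include hx in
/-- `0 < levelGap x n`. [folklore] -/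
theorem levelGap_pos : 0 < levelGap x n :=
  div_pos (lt_min (by linarith [marks_zero_lt_one hx]) (by linarith [marks_one_lt_two hx]))
    (by positivity)

include hx in
/-- `levelGap x n < x 1 - x 0`. [folklore] -/
theorem levelGap_lt₁ : levelGap x n < x 1 - x 0 := by
  unfold levelGap
  rw [div_lt_iff₀ (by positivity)]
  have h1 : min (x 1 - x 0) (x 2 - x 1) ≤ x 1 - x 0 := min_le_left _ _
  have h2 : 0 < x 1 - x 0 := by linarith [marks_zero_lt_one hx]
  nlinarith

include hx in
/-- `levelGap x n < x 2 - x 1`. [folklore] -/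
theorem levelGap_lt₂ : levelGap x n < x 2 - x 1 := by
  unfold levelGap
  rw [div_lt_iff₀ (by positivity)]
  have h1 : min (x 1 - x 0) (x 2 - x 1) ≤ x 2 - x 1 := min_le_right _ _
  have h2 : 0 < x 2 - x 1 := by linarith [marks_one_lt_two hx]
  nlinarith

/-- `levelLo` is antitone. [folklore] -/
theorem levelLo_antitone (hx0 : 0 < x 0) : Antitone (levelLo x) := fun a b hab ↦ by
  unfold levelLo
  exact div_le_div_of_nonneg_left hx0.le (by positivity) (by exact_mod_cast Nat.add_le_add_right hab 2)

/-- `levelHi` is monotone. [folklore] -/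
theorem levelHi_monotone : Monotone (levelHi x) := fun a b hab ↦ by
  unfold levelHi
  have : (a : ℝ) ≤ b := by exact_mod_cast hab
  linarith

/-- `levelGap` is antitone. [folklore] -/
theorem levelGap_antitone (hx : StrictMono x) : Antitone (levelGap x) := fun a b hab ↦ by
  unfold levelGap
  have h : 0 ≤ min (x 1 - x 0) (x 2 - x 1) :=
    le_min (by linarith [marks_zero_lt_one hx]) (by linarith [marks_one_lt_two hx])
  exact div_le_div_of_nonneg_left h (by positivity) (by exact_mod_cast Nat.add_le_add_right hab 2)

/-- `levelLo x n → 0`. [folklore] -/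
theorem tendsto_levelLo : Tendsto (levelLo x) atTop (𝓝 0) := by
  unfold levelLo
  have h := tendsto_const_div_atTop_nhds_zero_nat (x 0)
  have h2 : Tendsto (fun n : ℕ ↦ x 0 / ((n : ℝ) + 2)) atTop (𝓝 0) := by
    have := (tendsto_add_atTop_iff_nat 2).2 h
    refine this.congr fun n ↦ ?_
    push_cast; ring_nf
  exact h2

/-- `levelGap x n → 0`. [folklore] -/
theorem tendsto_levelGap : Tendsto (levelGap x) atTop (𝓝 0) := by
  unfold levelGap
  have h := tendsto_const_div_atTop_nhds_zero_nat (min (x 1 - x 0) (x 2 - x 1))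
  have := (tendsto_add_atTop_iff_nat 2).2 h
  refine this.congr fun n ↦ ?_
  push_cast; ring_nf

/-- `levelHi x n → ∞`. [folklore] -/
theorem tendsto_levelHi : Tendsto (levelHi x) atTop atTop := by
  unfold levelHi
  have h : Tendsto (fun n : ℕ ↦ (n : ℝ) + (x 0 + 1)) atTop atTop :=
    tendsto_atTop_add_const_right _ _ tendsto_natCast_atTop_atTop
  refine h.congr fun n ↦ ?_
  ring

end LevelFacts

/-! ### Exit times widen with the interval; the level stopping times increase to `T` -/

/-- The exit time from a larger open interval is later. [folklore] -/
theorem exitTime_mono_interval {u : ℝ≥0 → (ℝ≥0 → ℝ) → ℝ} {a b a' b' : ℝ} (ha : a' ≤ a)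
    (hb : b ≤ b') (ω : ℝ≥0 → ℝ) : Process.exitTime u a b ω ≤ Process.exitTime u a' b' ω := by
  have hsub : (Ioo a' b')ᶜ ⊆ (Ioo a b)ᶜ := compl_subset_compl.2 (Ioo_subset_Ioo ha hb)
  have := hittingAfter_anti u 0 hsub
  exact this ω

/-- A continuous path which stays inside `(a, b)` on `[0, s]` has exit time `> s`. [folklore] -/
theorem coe_lt_exitTime_of_forall_mem {u : ℝ≥0 → (ℝ≥0 → ℝ) → ℝ} {a b : ℝ} {ω : ℝ≥0 → ℝ}
    (hc : Continuous fun t ↦ u t ω) {s : ℝ≥0} (h : ∀ r ≤ s, u r ω ∈ Ioo a b) :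
    (s : WithTop ℝ≥0) < Process.exitTime u a b ω := by
  by_contra hle
  rw [not_lt, exitTime_le_coe_iff hc] at hle
  obtain ⟨j, hjs, hj⟩ := hle
  exact hj (h j hjs)

section RhoFacts

variable (hx : StrictMono x) (hx0 : 0 < x 0)
include hx hx0

/-- The level stopping times increase with `n` (the intervals widen). [folklore] -/
theorem cardyLevelTimeSeq_mono (ω : ℝ≥0 → ℝ) : Monotone fun n ↦ cardyLevelTimeSeq κ x n ω := by
  intro a b hab
  unfold cardyLevelTimeSeq cardyLevelTime
  refine min_le_min (exitTime_mono_interval (levelLo_antitone hx0 hab) (levelHi_monotone hab) ω)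
    (min_le_min (exitTime_mono_interval (levelGap_antitone hx hab) le_rfl ω)
      (exitTime_mono_interval (levelGap_antitone hx hab) le_rfl ω))

/-- `ρₙ ≤ T`. [folklore] -/
theorem cardyLevelTimeSeq_le (n : ℕ) (ω : ℝ≥0 → ℝ) :
    cardyLevelTimeSeq κ x n ω ≤ swallowingStoppingTime κ x ω :=
  cardyLevelTime_le_swallowingStoppingTime hx hx0 (levelLo_pos hx0 n) (levelLo_lt hx0 n) ω

/-- `ρₙ < T` when `T < ∞`. [folklore] -/
theorem cardyLevelTimeSeq_lt (n : ℕ) {ω : ℝ≥0 → ℝ} (hT : swallowingStoppingTime κ x ω ≠ ⊤) :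
    cardyLevelTimeSeq κ x n ω < swallowingStoppingTime κ x ω :=
  cardyLevelTime_lt_swallowingStoppingTime hx hx0 (levelLo_pos hx0 n) (levelLo_lt hx0 n) hT

/-- **`ρₙ ↑ T`**: every time `s` before the first swallowing time of the marks is eventually below
`ρₙ` (on `[0, s]` the flow `X⁰` and the gaps are bounded away from `0` and `∞` by compactness and
continuity). [folklore] -/
theorem eventually_coe_lt_cardyLevelTimeSeq {ω : ℝ≥0 → ℝ} {s : ℝ≥0}
    (hs : (s : WithTop ℝ≥0) < swallowingStoppingTime κ x ω) :
    ∀ᶠ n in atTop, (s : WithTop ℝ≥0) < cardyLevelTimeSeq κ x n ω := by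
  have hx1 : 0 < x 1 := marks_pos hx hx0 1
  have hx2 : 0 < x 2 := marks_pos hx hx0 2
  set X₀ := sleRealFlowStop κ (x 0) with hX₀
  set X₁ := sleRealFlowStop κ (x 1) with hX₁
  set X₂ := sleRealFlowStop κ (x 2) with hX₂
  have hc₀ : Continuous fun t ↦ X₀ t ω := continuous_sleRealFlowStop hx0.ne' ω
  have hc₀₁ : Continuous fun t ↦ X₁ t ω - X₀ t ω := continuous_gap (κ := κ) hx hx0 0 1 ω
  have hc₁₂ : Continuous fun t ↦ X₂ t ω - X₁ t ω := continuous_gap (κ := κ) hx hx0 1 2 ω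
  -- facts on `[0, s]`
  have hfacts : ∀ r ≤ s, 0 < X₀ r ω ∧ X₀ r ω < X₁ r ω ∧ X₁ r ω < X₂ r ω ∧
      X₁ r ω - X₀ r ω ≤ x 1 - x 0 ∧ X₂ r ω - X₁ r ω ≤ x 2 - x 1 := by
    intro r hr
    have hr' : (r : WithTop ℝ≥0) < swallowingTime (sleDriving κ ω) (x 0) := by
      rw [← swallowingStoppingTime_eq_holds hx hx0 ω]
      exact lt_of_le_of_lt (WithTop.coe_le_coe.2 hr) hs
    obtain ⟨h0, h01, h12, -, -⟩ := sleRealFlowStop_three_facts (κ := κ) hx hx0 hr'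
    exact ⟨h0, h01, h12, sleRealFlowStop_gap01_le hx hx0 hr', sleRealFlowStop_gap12_le hx hx0 hr'⟩
  -- extrema of the three continuous positive functions on the compact `[0, s]`
  have hK : IsCompact (Icc (0 : ℝ≥0) s) := isCompact_Icc
  have hne : (Icc (0 : ℝ≥0) s).Nonempty := ⟨0, left_mem_Icc.2 bot_le⟩
  obtain ⟨r₀, hr₀, hmin₀⟩ := hK.exists_isMinOn hne hc₀.continuousOn
  obtain ⟨r₁, hr₁, hmax₀⟩ := hK.exists_isMaxOn hne hc₀.continuousOn
  obtain ⟨r₂, hr₂, hmin₁⟩ := hK.exists_isMinOn hne hc₀₁.continuousOn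
  obtain ⟨r₃, hr₃, hmin₂⟩ := hK.exists_isMinOn hne hc₁₂.continuousOn
  have hμ₀ : 0 < X₀ r₀ ω := (hfacts r₀ hr₀.2).1
  have hμ₁ : 0 < X₁ r₂ ω - X₀ r₂ ω := by linarith [(hfacts r₂ hr₂.2).2.1]
  have hμ₂ : 0 < X₂ r₃ ω - X₁ r₃ ω := by linarith [(hfacts r₃ hr₃.2).2.2.1]
  -- eventually the levels are beyond the extrema
  have e1 : ∀ᶠ n in atTop, levelLo x n < X₀ r₀ ω := (tendsto_levelLo).eventually (gt_mem_nhds hμ₀)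
  have e2 : ∀ᶠ n in atTop, X₀ r₁ ω < levelHi x n := tendsto_levelHi.eventually (eventually_gt_atTop _)
  have e3 : ∀ᶠ n in atTop, levelGap x n < X₁ r₂ ω - X₀ r₂ ω :=
    (tendsto_levelGap).eventually (gt_mem_nhds hμ₁)
  have e4 : ∀ᶠ n in atTop, levelGap x n < X₂ r₃ ω - X₁ r₃ ω :=
    (tendsto_levelGap).eventually (gt_mem_nhds hμ₂)
  filter_upwards [e1, e2, e3, e4] with n h1 h2 h3 h4
  have hB₁ : x 1 - x 0 < x 2 - x 0 + 1 := by linarith [marks_one_lt_two hx]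
  have hB₂ : x 2 - x 1 < x 2 - x 0 + 1 := by linarith [marks_zero_lt_one hx]
  unfold cardyLevelTimeSeq cardyLevelTime
  refine lt_min (coe_lt_exitTime_of_forall_mem hc₀ fun r hr ↦ ⟨?_, ?_⟩)
    (lt_min (coe_lt_exitTime_of_forall_mem hc₀₁ fun r hr ↦ ⟨?_, ?_⟩)
      (coe_lt_exitTime_of_forall_mem hc₁₂ fun r hr ↦ ⟨?_, ?_⟩))
  · exact h1.trans_le (hmin₀ ⟨bot_le, hr⟩)
  · exact (hmax₀ ⟨bot_le, hr⟩).trans_lt h2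
  · exact h3.trans_le (hmin₁ ⟨bot_le, hr⟩)
  · exact (hfacts r hr).2.2.2.1.trans_lt hB₁
  · exact h4.trans_le (hmin₂ ⟨bot_le, hr⟩)
  · exact (hfacts r hr).2.2.2.2.trans_lt hB₂

end RhoFacts

/-! ### The stopped observables: bounds, continuity, identification, nesting, martingale -/

section ObsFacts

variable {m M d : ℝ} (hx : StrictMono x) (hx0 : 0 < x 0) (hm : 0 < m) (hmx : m < x 0)
  (hxM : x 0 < M) (hd : 0 < d) (hd₁ : d < x 1 - x 0) (hd₂ : d < x 2 - x 1)
include hx hx0 hm hmx hxM hd hd₁ hd₂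

/-- The cross-ratio of the stopped flows lies in `(0, 1)`. [folklore] -/
theorem cardyEta_stopped_mem_Ioo (t : ℝ≥0) (ω : ℝ≥0 → ℝ) :
    cardyEta (stoppedProcess (sleRealFlowStop κ (x 0)) (cardyLevelTime κ x m M d) t ω)
      (stoppedProcess (sleRealFlowStop κ (x 1)) (cardyLevelTime κ x m M d) t ω)
      (stoppedProcess (sleRealFlowStop κ (x 2)) (cardyLevelTime κ x m M d) t ω) ∈ Ioo 0 1 := by
  obtain ⟨-, -, -, h0, h01, h12⟩ := cardyLevel_stopped_bounds (κ := κ) hx hx0 hm hmx hxM hd hd₁ hd₂ ω t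
  exact cardyEta_mem_Ioo h0 h01 h12

/-- The stopped observable takes values in `[0, 1]`. [cite: WernerPCMI2009, §3] -/
theorem cardyObsStopped_mem_Icc (t : ℝ≥0) (ω : ℝ≥0 → ℝ) :
    cardyObsStopped κ x m M d t ω ∈ Icc (0 : ℝ) 1 :=
  cardyFunction_mem_Icc_holds (Ioo_subset_Icc_self
    (cardyEta_stopped_mem_Ioo hx hx0 hm hmx hxM hd hd₁ hd₂ t ω))

/-- `|cardyObsStopped| ≤ 1`. [folklore] -/
theorem abs_cardyObsStopped_le (t : ℝ≥0) (ω : ℝ≥0 → ℝ) : |cardyObsStopped κ x m M d t ω| ≤ 1 := by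
  have h := cardyObsStopped_mem_Icc (κ := κ) hx hx0 hm hmx hxM hd hd₁ hd₂ t ω
  rw [abs_le]; exact ⟨by linarith [h.1], h.2⟩

/-- The stopped observable is `cardyFunctionExt` of the stopped cross-ratio. [folklore] -/
theorem cardyObsStopped_eq_ext (t : ℝ≥0) (ω : ℝ≥0 → ℝ) :
    cardyObsStopped κ x m M d t ω = cardyFunctionExt (cardyEta
      (stoppedProcess (sleRealFlowStop κ (x 0)) (cardyLevelTime κ x m M d) t ω)
      (stoppedProcess (sleRealFlowStop κ (x 1)) (cardyLevelTime κ x m M d) t ω)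
      (stoppedProcess (sleRealFlowStop κ (x 2)) (cardyLevelTime κ x m M d) t ω)) := by
  rw [cardyObsStopped, cardyFunctionExt_of_mem (Ioo_subset_Icc_self
    (cardyEta_stopped_mem_Ioo hx hx0 hm hmx hxM hd hd₁ hd₂ t ω))]

/-- The stopped observable has continuous paths. [folklore] -/
theorem continuous_cardyObsStopped (ω : ℝ≥0 → ℝ) : Continuous fun t ↦ cardyObsStopped κ x m M d t ω := by
  have heq : (fun t ↦ cardyObsStopped κ x m M d t ω) = fun t ↦ cardyFunctionExt (cardyEta
      (stoppedProcess (sleRealFlowStop κ (x 0)) (cardyLevelTime κ x m M d) t ω)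
      (stoppedProcess (sleRealFlowStop κ (x 1)) (cardyLevelTime κ x m M d) t ω)
      (stoppedProcess (sleRealFlowStop κ (x 2)) (cardyLevelTime κ x m M d) t ω)) :=
    funext fun t ↦ cardyObsStopped_eq_ext hx hx0 hm hmx hxM hd hd₁ hd₂ t ω
  rw [heq]
  have hc : ∀ i, Continuous fun t ↦
      stoppedProcess (sleRealFlowStop κ (x i)) (cardyLevelTime κ x m M d) t ω := fun i ↦
    continuous_stoppedProcess_path (continuous_sleRealFlowStop (marks_pos hx hx0 i).ne' ω) _
  refine continuous_cardyFunctionExt.comp ?_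
  unfold cardyEta
  refine ((hc 0).mul ((hc 2).sub (hc 1))).div ((hc 1).mul ((hc 2).sub (hc 0))) fun t ↦ ?_
  obtain ⟨-, -, -, h0, h01, h12⟩ := cardyLevel_stopped_bounds (κ := κ) hx hx0 hm hmx hxM hd hd₁ hd₂ ω t
  exact (mul_pos (h0.trans h01) (by linarith)).ne'

/-- The stopped observable is strongly adapted. [folklore] -/
theorem stronglyAdapted_cardyObsStopped : StronglyAdapted brownianFiltration (cardyObsStopped κ x m M d) := by
  intro t
  have hρ := isStoppingTime_cardyLevelTime (κ := κ) hx hx0 m M d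
  have ha : ∀ i, StronglyMeasurable[brownianFiltration t]
      (stoppedProcess (sleRealFlowStop κ (x i)) (cardyLevelTime κ x m M d) t) := fun i ↦
    (isStronglyProgressive_sleRealFlowStop κ (marks_pos hx hx0 i).ne').stronglyAdapted_stoppedProcess hρ t
  have heq : cardyObsStopped κ x m M d t = fun ω ↦ cardyFunctionExt (cardyEta
      (stoppedProcess (sleRealFlowStop κ (x 0)) (cardyLevelTime κ x m M d) t ω)
      (stoppedProcess (sleRealFlowStop κ (x 1)) (cardyLevelTime κ x m M d) t ω)
      (stoppedProcess (sleRealFlowStop κ (x 2)) (cardyLevelTime κ x m M d) t ω)) :=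
    funext fun ω ↦ cardyObsStopped_eq_ext hx hx0 hm hmx hxM hd hd₁ hd₂ t ω
  rw [heq]
  refine continuous_cardyFunctionExt.comp_stronglyMeasurable ?_
  exact (((ha 0).measurable.mul ((ha 2).measurable.sub (ha 1).measurable)).div
    ((ha 1).measurable.mul ((ha 2).measurable.sub (ha 0).measurable))).stronglyMeasurable

/-- **Identification with the Cardy observable**: `cardyObsStopped κ x m M d t ω` is the Cardy
observable at the stopped time `t ∧ ρ` (which is strictly before the first swallowing time of the
marks). [cite: WernerPCMI2009, §3] -/
theorem cardyObsStopped_eq_cardyObservable (t : ℝ≥0) (ω : ℝ≥0 → ℝ) :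
    cardyObsStopped κ x m M d t ω =
      cardyObservable κ x (min (t : WithTop ℝ≥0) (cardyLevelTime κ x m M d ω)).untopA ω := by
  have h := (cardyLevel_bounds_of_le (κ := κ) hx hx0 hm hmx hxM hd hd₁ hd₂
    (coe_untopA_min_le t (cardyLevelTime κ x m M d ω))).1
  rw [cardyObservable_eq_cardyFunction_cardyEta h]
  rfl

omit hx hx0 hm hmx hxM hd hd₁ hd₂ in
/-- **Nesting of the stopped observables**: for wider levels `m' ≤ m`, `M ≤ M'`, `d' ≤ d`, the
narrower stopped observable is the wider one stopped at the narrower level stopping time.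
[folklore] -/
theorem cardyObsStopped_eq_stoppedProcess {m' M' d' : ℝ} (hm' : m' ≤ m) (hM' : M ≤ M')
    (hd' : d' ≤ d) :
    cardyObsStopped κ x m M d = stoppedProcess (cardyObsStopped κ x m' M' d')
      (cardyLevelTime κ x m M d) := by
  funext t ω
  have hρle : cardyLevelTime κ x m M d ω ≤ cardyLevelTime κ x m' M' d' ω := by
    unfold cardyLevelTime
    exact min_le_min (exitTime_mono_interval hm' hM' ω)
      (min_le_min (exitTime_mono_interval hd' le_rfl ω) (exitTime_mono_interval hd' le_rfl ω))
  have hu' : min (((min (t : WithTop ℝ≥0) (cardyLevelTime κ x m M d ω)).untopA : ℝ≥0) : WithTop ℝ≥0)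
      (cardyLevelTime κ x m' M' d' ω) =
      (((min (t : WithTop ℝ≥0) (cardyLevelTime κ x m M d ω)).untopA : ℝ≥0) : WithTop ℝ≥0) :=
    min_eq_left ((coe_untopA_min_le t _).trans hρle)
  simp only [cardyObsStopped, stoppedProcess]
  rw [hu']
  rfl

end ObsFacts

/-- **For `κ = 6` the stopped Cardy observable is a martingale** (the Itô drift vanishes,
`cardyDrift_six`; `martingale_cardyObservable_sub_timeIntegral` of `SLECardyIto`).
[cite: WernerPCMI2009, §3] -/
theorem martingale_cardyObsStopped_six {m M d : ℝ} (hx : StrictMono x) (hx0 : 0 < x 0) (hm : 0 < m)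
    (hmx : m < x 0) (hxM : x 0 < M) (hd : 0 < d) (hd₁ : d < x 1 - x 0) (hd₂ : d < x 2 - x 1) :
    Martingale (cardyObsStopped 6 x m M d) brownianFiltration preWienerMeasure := by
  have h := martingale_cardyObservable_sub_timeIntegral (κ := 6) (by norm_num) hx hx0 hm hmx hxM hd hd₁ hd₂
  have hzero : (trunc (cardyLevelTime 6 x m M d) fun s ω ↦
      cardyDrift 6 (sleRealFlowStop 6 (x 0) s ω) (sleRealFlowStop 6 (x 1) s ω)
        (sleRealFlowStop 6 (x 2) s ω)) = fun _ _ ↦ 0 := by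
    funext s ω
    simp only [trunc_apply, cardyDrift_six, ite_self]
  have hint : ∀ t ω, timeIntegral (trunc (cardyLevelTime 6 x m M d) fun s ω ↦
      cardyDrift 6 (sleRealFlowStop 6 (x 0) s ω) (sleRealFlowStop 6 (x 1) s ω)
        (sleRealFlowStop 6 (x 2) s ω)) t ω = 0 := by
    intro t ω; rw [hzero]; simp [timeIntegral]
  simp only [hint, sub_zero] at h
  exact h

end Levels

/-! ### The a.s. left limit at `T` and the martingale property of the Cardy observable (`κ = 6`) -/

section Six

/-- A Cauchy criterion for left limits: if for every `ε > 0` there is `r < T₀` such that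
`|g s - g r| < ε` for all `s ∈ [r, T₀)`, then `g` has a left limit at `T₀` (`ℝ` is complete).
[folklore] -/
theorem exists_tendsto_nhdsLT_of_osc {g : ℝ≥0 → ℝ} {T₀ : ℝ≥0}
    (h : ∀ ε > 0, ∃ r < T₀, ∀ s, r ≤ s → s < T₀ → |g s - g r| < ε) :
    ∃ c, Tendsto g (𝓝[<] T₀) (𝓝 c) := by
  obtain ⟨r₀, hr₀, -⟩ := h 1 one_pos
  haveI : (𝓝[<] T₀).NeBot := nhdsLT_neBot_of_exists_lt ⟨r₀, hr₀⟩
  rw [← cauchy_map_iff_exists_tendsto, Metric.cauchy_iff]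
  refine ⟨inferInstance, fun ε hε ↦ ?_⟩
  obtain ⟨r, hr, hrp⟩ := h (ε / 2) (half_pos hε)
  refine ⟨g '' Ico r T₀, image_mem_map (Ico_mem_nhdsLT hr), ?_⟩
  rintro _ ⟨s₁, hs₁, rfl⟩ _ ⟨s₂, hs₂, rfl⟩
  have h1 := hrp s₁ hs₁.1 hs₁.2
  have h2 := hrp s₂ hs₂.1 hs₂.2
  rw [Real.dist_eq]
  calc |g s₁ - g s₂| = |(g s₁ - g r) - (g s₂ - g r)| := by ring_nf
    _ ≤ |g s₁ - g r| + |g s₂ - g r| := abs_sub _ _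
    _ < ε / 2 + ε / 2 := add_lt_add h1 h2
    _ = ε := by ring

variable {x : Fin 3 → ℝ} (hx : StrictMono x) (hx0 : 0 < x 0)
include hx hx0

/-- **The stopped observables converge to the Cardy observable almost surely** (`κ = 6`): for
every `t`, for a.e. `ω`, `Mⁿ_t(ω) → cardyObservable 6 x t ω`, where
`Mⁿ = cardyObsStopped 6 x (levelLo x n) (levelHi x n) (levelGap x n)`. Before `T` the sequence is
eventually constant. From `T` on this is the a.s. existence of the left limit `lim_{s↑T} F(η_s)`,
proved by the `L²`/Doob argument described in the module docstring (orthogonality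
`integral_stoppedProcess_mul_eq_integral_sq`, Doob's maximal inequality
`doob_sq_maximal_ineq_of_continuous`, and `aₙ = E[(Mⁿ_t)²] ↑ a_∞`).
[cite: WernerPCMI2009, §3] -/
theorem ae_tendsto_cardyObsStopped_six (t : ℝ≥0) :
    ∀ᵐ ω ∂preWienerMeasure, Tendsto
      (fun n ↦ cardyObsStopped 6 x (levelLo x n) (levelHi x n) (levelGap x n) t ω) atTop
      (𝓝 (cardyObservable 6 x t ω)) := by
  haveI := isProbabilityMeasure_preWienerMeasure'
  -- the stopped observables `Mn n` and the level stopping times `ρn n`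
  set Mn : ℕ → ℝ≥0 → (ℝ≥0 → ℝ) → ℝ := fun n ↦
    cardyObsStopped 6 x (levelLo x n) (levelHi x n) (levelGap x n) with hMndef
  set ρn : ℕ → (ℝ≥0 → ℝ) → WithTop ℝ≥0 := fun n ↦ cardyLevelTimeSeq 6 x n with hρndef
  have hρneq : ∀ n, cardyLevelTime 6 x (levelLo x n) (levelHi x n) (levelGap x n) = ρn n :=
    fun n ↦ rfl
  have hlo := fun n ↦ levelLo_pos (x := x) hx0 n
  have hlo' := fun n ↦ levelLo_lt (x := x) hx0 n
  have hhi := fun n ↦ lt_levelHi (x := x) n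
  have hgap := fun n ↦ levelGap_pos (x := x) hx n
  have hgap₁ := fun n ↦ levelGap_lt₁ (x := x) hx n
  have hgap₂ := fun n ↦ levelGap_lt₂ (x := x) hx n
  have hmart : ∀ n, Martingale (Mn n) brownianFiltration preWienerMeasure := fun n ↦
    martingale_cardyObsStopped_six hx hx0 (hlo n) (hlo' n) (hhi n) (hgap n) (hgap₁ n) (hgap₂ n)
  have hcont : ∀ n ω, Continuous (Mn n · ω) := fun n ω ↦
    continuous_cardyObsStopped (κ := 6) hx hx0 (hlo n) (hlo' n) (hhi n) (hgap n) (hgap₁ n) (hgap₂ n) ω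
  have hbd : ∀ n s ω, |Mn n s ω| ≤ 1 := fun n s ω ↦
    abs_cardyObsStopped_le (κ := 6) hx hx0 (hlo n) (hlo' n) (hhi n) (hgap n) (hgap₁ n) (hgap₂ n) s ω
  have hρst : ∀ n, IsStoppingTime brownianFiltration (ρn n) := fun n ↦
    isStoppingTime_cardyLevelTime hx hx0 _ _ _
  have hρmono : ∀ ω, Monotone fun n ↦ ρn n ω := fun ω ↦ cardyLevelTimeSeq_mono (κ := 6) hx hx0 ω
  have hnest : ∀ {n n'}, n ≤ n' → Mn n = stoppedProcess (Mn n') (ρn n) := fun {n n'} h ↦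
    cardyObsStopped_eq_stoppedProcess (κ := 6) (levelLo_antitone hx0 h) (levelHi_monotone h)
      (levelGap_antitone hx h)
  have hident : ∀ n s ω, Mn n s ω = cardyObservable 6 x (min (s : WithTop ℝ≥0) (ρn n ω)).untopA ω :=
    fun n s ω ↦ cardyObsStopped_eq_cardyObservable (κ := 6) hx hx0 (hlo n) (hlo' n) (hhi n) (hgap n)
      (hgap₁ n) (hgap₂ n) s ω
  have hmeas : ∀ n s, AEStronglyMeasurable (Mn n s) preWienerMeasure := fun n s ↦
    (((hmart n).stronglyMeasurable s).mono (brownianFiltration.le s)).aestronglyMeasurable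
  have hint2 : ∀ n n' s, Integrable (fun ω ↦ Mn n s ω * Mn n' s ω) preWienerMeasure := by
    intro n n' s
    refine (integrable_const (1 : ℝ)).mono' ((hmeas n s).mul (hmeas n' s)) (ae_of_all _ fun ω ↦ ?_)
    rw [Real.norm_eq_abs, abs_mul]
    exact mul_le_one₀ (hbd n s ω) (abs_nonneg _) (hbd n' s ω)
  /- Step 1: `aₙ = E[(Mⁿ_t)²]` is increasing and bounded; `E[(Mⁿ'_t - Mⁿ_t)²] = aₙ' - aₙ`. -/
  set a : ℕ → ℝ := fun n ↦ ∫ ω, Mn n t ω ^ 2 ∂preWienerMeasure with hadef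
  have horth : ∀ {n n'}, n ≤ n' → ∫ ω, Mn n t ω * Mn n' t ω ∂preWienerMeasure = a n := by
    intro n n' h
    have := integral_stoppedProcess_mul_eq_integral_sq (hmart n') (hcont n') (hbd n') (hρst n) t
    rw [← hnest h] at this
    exact this
  have hsq : ∀ {n n'}, n ≤ n' →
      ∫ ω, (Mn n' t ω - Mn n t ω) ^ 2 ∂preWienerMeasure = a n' - a n := by
    intro n n' h
    have he : ∀ ω, (Mn n' t ω - Mn n t ω) ^ 2 =
        Mn n' t ω * Mn n' t ω - 2 * (Mn n t ω * Mn n' t ω) + Mn n t ω * Mn n t ω := fun ω ↦ by ring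
    simp_rw [he]
    have e1 : ∫ ω, (Mn n' t ω * Mn n' t ω - 2 * (Mn n t ω * Mn n' t ω) + Mn n t ω * Mn n t ω)
        ∂preWienerMeasure = (∫ ω, (Mn n' t ω * Mn n' t ω - 2 * (Mn n t ω * Mn n' t ω))
        ∂preWienerMeasure) + ∫ ω, Mn n t ω * Mn n t ω ∂preWienerMeasure :=
      integral_add ((hint2 n' n' t).sub ((hint2 n n' t).const_mul 2)) (hint2 n n t)
    have e2 : ∫ ω, (Mn n' t ω * Mn n' t ω - 2 * (Mn n t ω * Mn n' t ω)) ∂preWienerMeasure =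
        (∫ ω, Mn n' t ω * Mn n' t ω ∂preWienerMeasure) -
          ∫ ω, 2 * (Mn n t ω * Mn n' t ω) ∂preWienerMeasure :=
      integral_sub (hint2 n' n' t) ((hint2 n n' t).const_mul 2)
    have e3 : ∫ ω, 2 * (Mn n t ω * Mn n' t ω) ∂preWienerMeasure =
        2 * ∫ ω, Mn n t ω * Mn n' t ω ∂preWienerMeasure := integral_const_mul _ _
    have h1 : ∫ ω, Mn n' t ω * Mn n' t ω ∂preWienerMeasure = a n' := by
      simp only [hadef, sq]
    have h2 : ∫ ω, Mn n t ω * Mn n t ω ∂preWienerMeasure = a n := by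
      simp only [hadef, sq]
    rw [e1, e2, e3, horth h, h1, h2]; ring
  have hamono : Monotone a := by
    refine monotone_nat_of_le_succ fun n ↦ ?_
    have h := hsq (Nat.le_succ n)
    have hnn : 0 ≤ ∫ ω, (Mn (n + 1) t ω - Mn n t ω) ^ 2 ∂preWienerMeasure :=
      integral_nonneg fun ω ↦ sq_nonneg _
    linarith
  have habd : ∀ n, a n ≤ 1 := by
    intro n
    have h1 : ∫ ω, Mn n t ω ^ 2 ∂preWienerMeasure ≤ ∫ _, (1 : ℝ) ∂preWienerMeasure := by
      refine integral_mono ((hint2 n n t).congr (ae_of_all _ fun ω ↦ by simp [sq]))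
        (integrable_const _) fun ω ↦ ?_
      have := hbd n t ω
      rw [abs_le] at this
      nlinarith
    simpa using h1
  have hbdd : BddAbove (range a) := ⟨1, by rintro _ ⟨n, rfl⟩; exact habd n⟩
  set aSup : ℝ := ⨆ n, a n with haSup
  have hale : ∀ n, a n ≤ aSup := fun n ↦ le_ciSup hbdd n
  have halim : Tendsto a atTop (𝓝 aSup) := tendsto_atTop_ciSup hamono hbdd
  /- Step 2: Doob's maximal inequality for `Mⁿ' - Mⁿ`. -/
  have hdoob : ∀ {ε : ℝ}, 0 < ε → ∀ {n n'}, n ≤ n' →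
      preWienerMeasure {ω | ∃ s ≤ t, ε ≤ |Mn n' s ω - Mn n s ω|} ≤
        ENNReal.ofReal ((aSup - a n) / ε ^ 2) := by
    intro ε hε n n' h
    have hD : Martingale (Mn n' - Mn n) brownianFiltration preWienerMeasure := (hmart n').sub (hmart n)
    have hL2 : ∀ s, MemLp ((Mn n' - Mn n) s) 2 preWienerMeasure := fun s ↦
      MemLp.of_bound ((hmeas n' s).sub (hmeas n s)) 2 (ae_of_all _ fun ω ↦ by
        rw [Real.norm_eq_abs]
        calc |(Mn n' - Mn n) s ω| = |Mn n' s ω - Mn n s ω| := rfl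
          _ ≤ |Mn n' s ω| + |Mn n s ω| := abs_sub _ _
          _ ≤ 1 + 1 := add_le_add (hbd n' s ω) (hbd n s ω)
          _ = 2 := by norm_num)
    have hDc : ∀ᵐ ω ∂preWienerMeasure, Continuous ((Mn n' - Mn n) · ω) :=
      ae_of_all _ fun ω ↦ (hcont n' ω).sub (hcont n ω)
    have h1 := doob_sq_maximal_ineq_of_continuous hD hL2 hDc hε t
    have h2 : (∫ ω, (Mn n' - Mn n) t ω ^ 2 ∂preWienerMeasure) = a n' - a n := hsq h
    rw [h2] at h1
    refine h1.trans (ENNReal.ofReal_le_ofReal ?_)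
    exact div_le_div_of_nonneg_right (by linarith [hale n']) (sq_nonneg _)
  /- Step 3: the oscillation events `F n k` and their union `E n`. -/
  set F : ℝ → ℕ → ℕ → Set (ℝ≥0 → ℝ) := fun ε n k ↦
    {ω | ∃ s ≤ t, ε ≤ |Mn (n + k) s ω - Mn n s ω|} with hFdef
  have hFmono : ∀ ε n, Monotone (F ε n) := by
    intro ε n
    refine monotone_nat_of_le_succ fun k ↦ ?_
    rintro ω ⟨s, hst, hs⟩
    -- re-time at `s' = s ∧ ρ_{n+k}`
    set s' : ℝ≥0 := (min (s : WithTop ℝ≥0) (ρn (n + k) ω)).untopA with hs'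
    have hs't : s' ≤ t := (untopA_min_coe_le s _).trans hst
    have h1 : Mn (n + k) s ω = Mn (n + (k + 1)) s' ω := by
      rw [hnest (Nat.le_succ (n + k))]; rfl
    have h2 : Mn n s ω = Mn n s' ω := by
      rw [hnest (Nat.le_add_right n k)]
      simp only [stoppedProcess]
      congr 2
      rw [hs', coe_untopA_min, min_comm (s : WithTop ℝ≥0) (ρn (n + k) ω), min_assoc,
        min_eq_right (a := ρn (n + k) ω)]
      exact min_le_of_right_le (hρmono ω (Nat.le_add_right n k))
    refine ⟨s', hs't, ?_⟩
    rw [← h1, ← h2]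
    exact hs
  have hFle : ∀ {ε : ℝ}, 0 < ε → ∀ n k, preWienerMeasure (F ε n k) ≤
      ENNReal.ofReal ((aSup - a n) / ε ^ 2) := fun hε n k ↦ hdoob hε (Nat.le_add_right n k)
  have hEle : ∀ {ε : ℝ}, 0 < ε → ∀ n, preWienerMeasure (⋃ k, F ε n k) ≤
      ENNReal.ofReal ((aSup - a n) / ε ^ 2) := fun {ε} hε n ↦
    le_of_tendsto' (tendsto_measure_iUnion_atTop (hFmono ε n)) fun k ↦ hFle hε n k
  -- the bad sets `⋂ₙ ⋃ₖ F ε n k` are null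
  have hBnull : ∀ {ε : ℝ}, 0 < ε → preWienerMeasure (⋂ n, ⋃ k, F ε n k) = 0 := by
    intro ε hε
    have hlim : Tendsto (fun n ↦ ENNReal.ofReal ((aSup - a n) / ε ^ 2)) atTop (𝓝 0) := by
      rw [← ENNReal.ofReal_zero]
      refine ENNReal.tendsto_ofReal ?_
      have : Tendsto (fun n ↦ (aSup - a n) / ε ^ 2) atTop (𝓝 ((aSup - aSup) / ε ^ 2)) :=
        (tendsto_const_nhds.sub halim).div_const _
      simpa using this
    refine le_antisymm (ge_of_tendsto' hlim fun n ↦ ?_) bot_le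
    exact (measure_mono (iInter_subset _ n)).trans (hEle hε n)
  set Nset : Set (ℝ≥0 → ℝ) := ⋃ k : ℕ, ⋂ n, ⋃ k', F (1 / ((k : ℝ) + 1)) n k' with hNset
  have hNnull : preWienerMeasure Nset = 0 :=
    measure_iUnion_null fun k ↦ hBnull (by positivity)
  have hae : ∀ᵐ ω ∂preWienerMeasure, ω ∉ Nset := compl_mem_ae_iff.2 hNnull
  /- Step 4: the pointwise argument off the null set. -/
  filter_upwards [hae] with ω hω
  -- unpack: for every `k` some `n` with no `1/(k+1)`-oscillation after `n`
  have hgood : ∀ k : ℕ, ∃ n, ∀ k' s, s ≤ t →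
      |Mn (n + k') s ω - Mn n s ω| < 1 / ((k : ℝ) + 1) := by
    intro k
    have h1 : ω ∉ ⋂ n, ⋃ k', F (1 / ((k : ℝ) + 1)) n k' := fun h ↦ hω (mem_iUnion.2 ⟨k, h⟩)
    rw [mem_iInter] at h1
    obtain ⟨n, hn⟩ := not_forall.1 h1
    refine ⟨n, fun k' s hs ↦ ?_⟩
    by_contra hcon
    exact hn (mem_iUnion.2 ⟨k', s, hs, not_lt.1 hcon⟩)
  set T := swallowingStoppingTime 6 x ω with hTdef
  by_cases htT : (t : WithTop ℝ≥0) < T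
  · -- before `T`: eventually constant
    have hev := eventually_coe_lt_cardyLevelTimeSeq (κ := 6) hx hx0 htT
    refine tendsto_const_nhds.congr' ?_
    filter_upwards [hev] with n hn
    have hn' : (t : WithTop ℝ≥0) ≤ ρn n ω := hn.le
    show cardyObservable 6 x t ω = Mn n t ω
    rw [hident n t ω, min_eq_left hn']
    rfl
  · -- from `T` on: the left limit exists
    have hTt : T ≤ t := not_lt.1 htT
    have hTne : T ≠ ⊤ := ne_top_of_le_ne_top WithTop.coe_ne_top hTt
    obtain ⟨T₀, hT₀⟩ := WithTop.ne_top_iff_exists.1 hTne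
    have hT₀t : T₀ ≤ t := by rw [← hT₀] at hTt; exact WithTop.coe_le_coe.1 hTt
    -- the path `g` and the evaluation times `r n = ρₙ`
    set g : ℝ≥0 → ℝ := fun s ↦ cardyFunction (cardyCrossRatio 6 x s ω) with hgdef
    set r : ℕ → ℝ≥0 := fun n ↦ (min (t : WithTop ℝ≥0) (ρn n ω)).untopA with hrdef
    have hρlt : ∀ n, ρn n ω < T := fun n ↦ cardyLevelTimeSeq_lt (κ := 6) hx hx0 n hTne
    have hρle_t : ∀ n, ρn n ω ≤ t := fun n ↦ (hρlt n).le.trans hTt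
    have hrn : ∀ n, ((r n : ℝ≥0) : WithTop ℝ≥0) = ρn n ω := fun n ↦ by
      rw [hrdef, coe_untopA_min, min_eq_right (hρle_t n)]
    have hrT : ∀ n, r n < T₀ := fun n ↦ by
      have := hρlt n; rw [← hrn n, ← hT₀, WithTop.coe_lt_coe] at this; exact this
    have hMn_r : ∀ n, Mn n t ω = g (r n) := fun n ↦ by
      have h1 : Mn n t ω = cardyObservable 6 x (r n) ω := hident n t ω
      rw [h1]
      exact cardyObservable_of_lt (by rw [hrn n]; exact hρlt n)
    -- values of `Mⁿ` before and after `ρₙ`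
    have hval : ∀ {n k' : ℕ} {s : ℝ≥0}, r n ≤ s → (s : WithTop ℝ≥0) < ρn (n + k') ω →
        Mn (n + k') s ω = g s ∧ Mn n s ω = g (r n) := by
      intro n k' s hrs hsρ
      constructor
      · rw [hident (n + k') s ω, min_eq_left hsρ.le]
        exact cardyObservable_of_lt (hsρ.trans_le (cardyLevelTimeSeq_le (κ := 6) hx hx0 _ ω))
      · rw [hident n s ω]
        have hmin : min (s : WithTop ℝ≥0) (ρn n ω) = ((r n : ℝ≥0) : WithTop ℝ≥0) := by
          rw [hrn n]; exact min_eq_right (by rw [← hrn n]; exact WithTop.coe_le_coe.2 hrs)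
        rw [hmin]
        show cardyObservable 6 x (r n) ω = g (r n)
        exact cardyObservable_of_lt (by rw [hrn n]; exact hρlt n)
    -- the Cauchy property of `g` at `T₀-`
    have hosc : ∀ ε > 0, ∃ r₀ < T₀, ∀ s, r₀ ≤ s → s < T₀ → |g s - g r₀| < ε := by
      intro ε hε
      obtain ⟨k, hk⟩ := exists_nat_one_div_lt hε
      obtain ⟨n, hn⟩ := hgood k
      refine ⟨r n, hrT n, fun s hrs hsT ↦ ?_⟩
      have hsT' : (s : WithTop ℝ≥0) < T := by rw [← hT₀]; exact WithTop.coe_lt_coe.2 hsT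
      obtain ⟨n', hn'1, hn'2⟩ := ((eventually_coe_lt_cardyLevelTimeSeq (κ := 6) hx hx0 hsT').and
        (eventually_ge_atTop n)).exists
      obtain ⟨k', rfl⟩ := Nat.exists_eq_add_of_le hn'2
      obtain ⟨h1, h2⟩ := hval hrs hn'1
      have := hn k' s (hsT.le.trans hT₀t)
      rw [h1, h2] at this
      exact this.trans hk
    obtain ⟨c, hc⟩ := exists_tendsto_nhdsLT_of_osc hosc
    -- the observable at `t` is the left limit `c`
    haveI : (𝓝[<] T₀).NeBot := nhdsLT_neBot_of_exists_lt ⟨r 0, hrT 0⟩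
    have hYt : cardyObservable 6 x t ω = c := by
      rw [cardyObservable_of_le hTt]
      have : (swallowingStoppingTime 6 x ω).untopA = T₀ := by rw [← hTdef, ← hT₀]; rfl
      rw [this]
      exact hc.limUnder_eq
    rw [hYt]
    -- `r n → T₀` from below, hence `Mⁿ_t = g(r n) → c`
    have hrlim : Tendsto r atTop (𝓝[<] T₀) := by
      refine tendsto_nhdsWithin_iff.2 ⟨?_, Eventually.of_forall fun n ↦ hrT n⟩
      refine tendsto_order.2 ⟨fun s hs ↦ ?_, fun s hs ↦ Eventually.of_forall fun n ↦ (hrT n).trans hs⟩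
      have hsT' : (s : WithTop ℝ≥0) < T := by rw [← hT₀]; exact WithTop.coe_lt_coe.2 hs
      filter_upwards [eventually_coe_lt_cardyLevelTimeSeq (κ := 6) hx hx0 hsT'] with n hn
      have hn' : (s : WithTop ℝ≥0) < ρn n ω := hn
      rw [← hrn n, WithTop.coe_lt_coe] at hn'
      exact hn'
    have := hc.comp hrlim
    refine this.congr fun n ↦ ?_
    exact (hMn_r n).symm

/-- **The Cardy observable of SLE₆ is a martingale** of the raw Brownian filtration under the
(pre-)Wiener measure (marks `0 < x₀ < x₁ < x₂`): the bounded (by `1`) stopped observables `Mⁿ`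
are martingales (`martingale_cardyObsStopped_six`), converge almost surely to the observable
(`ae_tendsto_cardyObsStopped_six`), and the observable is strongly adapted
(`stronglyAdapted_cardyObservable_holds`, `SLEMartingaleProofs`); bounded a.s. limits of
martingales are martingales
(`martingale_of_tendsto_of_abs_le`). This is the direction "`κ = 6` ⟹ local martingale" of
crit-perc.S22 (Lawler–Schramm–Werner's bounded continuous martingale `F(η_{t∧T})`).
[cite: WernerPCMI2009, §3] -/
theorem martingale_cardyObservable_six :
    Martingale (cardyObservable 6 x) brownianFiltration preWienerMeasure := by
  haveI := isProbabilityMeasure_preWienerMeasure'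
  refine martingale_of_tendsto_of_abs_le (C := fun _ ↦ 1)
    (M := fun n ↦ cardyObsStopped 6 x (levelLo x n) (levelHi x n) (levelGap x n))
    (fun n ↦ martingale_cardyObsStopped_six hx hx0 (levelLo_pos hx0 n) (levelLo_lt hx0 n)
      (lt_levelHi n) (levelGap_pos hx n) (levelGap_lt₁ hx n) (levelGap_lt₂ hx n))
    (fun n i ω ↦ abs_cardyObsStopped_le (κ := 6) hx hx0 (levelLo_pos hx0 n) (levelLo_lt hx0 n)
      (lt_levelHi n) (levelGap_pos hx n) (levelGap_lt₁ hx n) (levelGap_lt₂ hx n) i ω)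
    (fun i ↦ ae_tendsto_cardyObsStopped_six hx hx0 i)
    (stronglyAdapted_cardyObservable_holds 6 x)

/-- **crit-perc.S22, direction `κ = 6`**: the Cardy observable of SLE₆, stopped at the first
swallowing time of the marks, is a local martingale (indeed a bounded martingale).
[cite: WernerPCMI2009, §3] -/
theorem isLocalMartingale_cardyObservable_six :
    IsLocalMartingale (stoppedProcess (cardyObservable 6 x) (swallowingStoppingTime 6 x))
      brownianFiltration preWienerMeasure := by
  rw [stoppedProcess_cardyObservable]
  exact (martingale_cardyObservable_six hx hx0).isLocalMartingale

end Six

end Literature.Probability.RandomPlanarGeometry
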